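import Summits.KontsevichZagierPeriods.KontsevichZagierPeriods.Theorems.RealPeriodSectorComplete.Negative.Data

/-!
# `RealPeriodSectorComplete` (stmt-KontsevichZagierPeriods-5381) — part 3: the summit implies the crux

`realPeriodSectorComplete_of_kontsevichZagierPeriods : KontsevichZagierPeriods →
RealPeriodSectorComplete`. Each real-sector representation `[{P>0}, a/√P]` (`a > 0`) is ONE
Newton–Leibniz move (primitive `F(x,t) = t`, lower function `0`, upper function `a/√P`) from the
RATIONAL dimension-2 representation `[band, 1]`, `band = {(x,t) | P(x) > 0, 0 ≤ t ≤ a/√P(x)}`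
(semialgebraic: closed hypograph of a semialgebraic function, Tarski–Seidenberg, tree lemma
`IsSemialgebraicFunOn.isSemialgebraic_setOf_le`; finite volume: it lies in the region between
`−a/√P` and `2a/√P`, `volume_regionBetween_eq_lintegral'`). Conjecture 1 for the two areas (equal
values by soundness of the lifts) and composition of moves give the crux. CONSEQUENCE for the
adversary: the crux is exactly the restriction of Conjecture 1 to this sector — it can be refuted
only by refuting the summit as formalised. (cdisprove seat gen 1.)
[cite: KontsevichZagier2001, §1.2 Conjecture 1; §1.1 remark after the Definition]
-/

noncomputable section

open MeasureTheory Set Filter MvPolynomial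
open Literature.ModelTheory.ExponentialFields (IsSemialgebraic isSemialgebraic_setOf_eval_pos
  isSemialgebraic_setOf_eval_eq_zero)
open Literature.NumberTheory.Transcendental
open Literature.NumberTheory.Transcendental.KZ

namespace Summit.KontsevichZagierPeriods.IsogenyCertificates.RealPeriodSectorCompleteNegative

open Summit.KontsevichZagierPeriods.KontsevichZagierPeriods.Theses.IsogenyCertificates
  (RealPeriodSectorComplete)

/-! ## §6 The summit implies the crux — so its truth fails only with the summit

An algebraic dimension-1 representation `[{P>0}, a/√P]` (`a > 0`) is ONE Newton–Leibniz move away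
from a RATIONAL dimension-2 representation: the area `[band, 1]`,
`band = {(x, t) | P(x) > 0, 0 ≤ t ≤ a/√P(x)}`, primitive `F(x, t) = t`. Conjecture 1 applied to the
two areas transfers back along the two moves. -/

/-- The crux integrand is Borel measurable on all of `ℝ¹` (junk values off `{P>0}` included). [folklore] -/
theorem measurable_integrand (A B : ℤ) (a : ℚ) : Measurable (integrand A B a) := by
  unfold integrand
  fun_prop

/-- On `{P > 0}` the integrand is positive for `a > 0`. [folklore] -/
theorem integrand_pos {A B : ℤ} {a : ℚ} (ha : 0 < a) {x : Fin 1 → ℝ} (hx : x ∈ dom A B) :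
    0 < integrand A B a x :=
  div_pos (by exact_mod_cast ha) (Real.sqrt_pos.2 hx)

/-- The band `{(x, t) | P(x) > 0, 0 ≤ t ≤ a/√P(x)} ⊆ ℝ²`, in the literal shape of the
Newton–Leibniz move (base `{P>0}`, lower function `0`, upper function `a/√P`). -/
def band (A B : ℤ) (a : ℚ) : Set (Fin 2 → ℝ) :=
  {z | (Fin.init z : Fin 1 → ℝ) ∈ dom A B ∧ (fun _ : Fin 1 → ℝ => (0 : ℝ)) (Fin.init z) ≤ z (Fin.last 1) ∧
    z (Fin.last 1) ≤ integrand A B a (Fin.init z)}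

/-- The band is `ℚ`-semialgebraic (closed hypograph of a semialgebraic function, Tarski–Seidenberg,
cut by `t ≥ 0`). [folklore] -/
theorem isSemialgebraic_band (A B : ℤ) (a : ℚ) : IsSemialgebraic ℚ (band A B a) := by
  have h1 := (isSemialgebraicFunOn_integrand A B a).isSemialgebraic_setOf_le
    Literature.ModelTheory.ExponentialFields.tarski_seidenberg_real_holds
  have h2 : IsSemialgebraic ℚ {v : Fin 2 → ℝ | 0 ≤ v (Fin.last 1)} := by
    have := Literature.ModelTheory.ExponentialFields.isSemialgebraic_setOf_eval_nonneg (k := ℚ)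
      (R := ℝ) (X (Fin.last 1) : MvPolynomial (Fin 2) ℚ)
    simpa using this
  convert h1.inter h2 using 1
  ext z
  simp only [band, mem_setOf_eq, mem_inter_iff]
  tauto

/-- The band has finite volume: `≤ ∫_{P>0} 3a/√P < ∞` (it lies in the region between `−a/√P` and
`2a/√P`, whose volume is a Lebesgue integral by `volume_regionBetween_eq_lintegral'`). [folklore] -/
theorem volume_band_lt_top {A B : ℤ} {a : ℚ} (ha : 0 < a)
    (hint : IntegrableOn (integrand A B a) (dom A B)) : volume (band A B a) < ⊤ := by
  have hσ : MeasurableSet (dom A B) :=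
    Literature.ModelTheory.ExponentialFields.IsSemialgebraic.measurableSet_holds (isSemialgebraic_dom A B)
  have hg : Measurable (integrand A B a) := measurable_integrand A B a
  set e : (Fin 2 → ℝ) ≃ᵐ ℝ × (Fin 1 → ℝ) :=
    MeasurableEquiv.piFinSuccAbove (fun _ => ℝ) (Fin.last 1) with he_def
  have he : MeasurePreserving e volume volume :=
    volume_preserving_piFinSuccAbove (fun _ => ℝ) (Fin.last 1)
  have he_symm : ∀ p : ℝ × (Fin 1 → ℝ), e.symm p = Fin.snoc p.2 p.1 := fun p => by
    rw [he_def]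
    exact Fin.insertNth_last' p.1 p.2
  have h1 : volume (band A B a) = volume (e.symm ⁻¹' band A B a) :=
    ((he.symm e).measure_preimage_equiv (band A B a)).symm
  set R : Set ((Fin 1 → ℝ) × ℝ) :=
    regionBetween (-integrand A B a) (fun x => 2 * integrand A B a x) (dom A B) with hR_def
  have hRm : MeasurableSet R := measurableSet_regionBetween hg.neg (hg.const_mul 2) hσ
  have hsub : e.symm ⁻¹' band A B a ⊆ Prod.swap ⁻¹' R := by
    intro p hp
    have hp' : Fin.snoc p.2 p.1 ∈ band A B a := by simpa [he_symm] using hp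
    obtain ⟨hσp, h0, hle⟩ := hp'
    rw [Fin.init_snoc] at hσp hle
    rw [Fin.snoc_last] at h0 hle
    have hgpos : 0 < integrand A B a p.2 := integrand_pos ha hσp
    refine ⟨hσp, ?_, ?_⟩
    · show -integrand A B a p.2 < p.1
      have : (0 : ℝ) ≤ p.1 := h0
      linarith
    · show p.1 < 2 * integrand A B a p.2
      linarith
  have hvol : volume (Prod.swap ⁻¹' R) = (volume : Measure (Fin 1 → ℝ)).prod volume R := by
    rw [Measure.volume_eq_prod]
    exact (Measure.measurePreserving_swap).measure_preimage hRm.nullMeasurableSet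
  rw [h1]
  refine (measure_mono hsub).trans_lt ?_
  rw [hvol, hR_def, volume_regionBetween_eq_lintegral' hg.neg (hg.const_mul 2) hσ]
  have h3 : IntegrableOn (fun x => 3 * integrand A B a x) (dom A B) := hint.const_mul 3
  calc ∫⁻ y in dom A B, ENNReal.ofReal (((fun x => 2 * integrand A B a x) - (-integrand A B a)) y)
      = ∫⁻ y in dom A B, ENNReal.ofReal (3 * integrand A B a y) := by
        congr 1
        funext y
        simp only [Pi.sub_apply, Pi.neg_apply]
        ring_nf
    _ ≤ ∫⁻ y in dom A B, ‖3 * integrand A B a y‖ₑ := lintegral_ofReal_le_lintegral_enorm _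
    _ < ⊤ := h3.2

/-- Integrability of `a/√P` on `{P>0}` is part of any representation satisfying the hypotheses. [folklore] -/
theorem integrableOn_of_rep {A B : ℤ} {a : ℚ} (r : IntegralRep 1) (hd : r.domain = dom A B)
    (hi : EqOn r.integrand (integrand A B a) r.domain) : IntegrableOn (integrand A B a) (dom A B) := by
  rw [← hd]
  exact r.integrableOn.congr_fun hi (IntegralRep.measurableSet_domain_holds r)

/-- The RATIONAL dimension-2 representation `[band, 1]` (the area under the graph of `a/√P`). -/
def bandRep (A B : ℤ) (a : ℚ) (ha : 0 < a) (hint : IntegrableOn (integrand A B a) (dom A B)) :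
    IntegralRep 2 where
  domain := band A B a
  integrand := fun _ => 1
  isSemialgebraic_domain := isSemialgebraic_band A B a
  isSemialgebraicFunOn_integrand :=
    isSemialgebraicFunOn_const_of_isAlgebraic (isSemialgebraic_band A B a) isAlgebraic_one
  integrableOn := (integrableOn_const_iff (by simp)).2 (Or.inr (volume_band_lt_top ha hint))

/-- `[band, 1]` has KZ's literal rational shape (`1 = 1/1`). [folklore] -/
theorem isRational_bandRep (A B : ℤ) (a : ℚ) (ha : 0 < a)
    (hint : IntegrableOn (integrand A B a) (dom A B)) : (bandRep A B a ha hint).IsRational :=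
  ⟨1, 1, fun x _ => by simp, fun x _ => by simp [bandRep]⟩

/-- **The lift is one Newton–Leibniz move**: `[band, 1] − [{P>0}, a/√P] ∈ newtonLeibnizRel`
(primitive `F(x,t) = t`, lower function `0`, upper function `a/√P`). [folklore] -/
theorem of_bandRep_sub_of_mem_newtonLeibnizRel {A B : ℤ} {a : ℚ} (ha : 0 < a) (r : IntegralRep 1)
    (hd : r.domain = dom A B) (hi : EqOn r.integrand (integrand A B a) r.domain) :
    KZ.of (bandRep A B a ha (integrableOn_of_rep r hd hi)) - KZ.of r ∈ newtonLeibnizRel := by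
  refine ⟨1, bandRep A B a ha (integrableOn_of_rep r hd hi), r, fun _ => 0, integrand A B a,
    fun z => z (Fin.last 1), ?_, ?_, ?_, ?_, ?_, ?_, ?_, ?_, rfl⟩
  · have := isSemialgebraicFunOn_aeval (isSemialgebraic_band A B a)
      (X (Fin.last 1) : MvPolynomial (Fin 2) ℚ)
    refine this.congr (fun z _ => ?_)
    simp
  · rw [hd]
    exact isSemialgebraicFunOn_const_of_isAlgebraic (isSemialgebraic_dom A B) isAlgebraic_zero
  · rw [hd]
    exact isSemialgebraicFunOn_integrand A B a
  · intro x hx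
    rw [hd] at hx
    exact (integrand_pos ha hx).le
  · show band A B a = _
    rw [hd]
    rfl
  · intro x _
    have : (fun t : ℝ => (Fin.snoc x t : Fin 2 → ℝ) (Fin.last 1)) = id :=
      funext fun t => Fin.snoc_last _ _
    rw [this]
    exact continuousOn_id
  · intro x _ t _
    show HasDerivAt (fun s : ℝ => (Fin.snoc x s : Fin 2 → ℝ) (Fin.last 1)) 1 t
    have : (fun s : ℝ => (Fin.snoc x s : Fin 2 → ℝ) (Fin.last 1)) = id :=
      funext fun s => Fin.snoc_last _ _
    rw [this]
    exact hasDerivAt_id t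
  · intro x hx
    beta_reduce
    rw [Fin.snoc_last, Fin.snoc_last, sub_zero]
    exact hi hx

/-- **The summit implies the crux**: `RealPeriodSectorComplete` is a consequence of Conjecture 1
(`KontsevichZagierPeriods`), via the two Newton–Leibniz lifts and soundness (the lifts preserve
values, so the two rational areas have equal values). Hence the crux can fail only together with
the summit: no refutation of it short of a disproof of the Kontsevich–Zagier conjecture as
formalised. [folklore] -/
theorem realPeriodSectorComplete_of_kontsevichZagierPeriods (h : KontsevichZagierPeriods) :
    RealPeriodSectorComplete := by
  intro A B A' B' _ _ a b ha hb r r' hd hi hd' hi' hv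
  have hE : Equivalent (bandRep A B a ha (integrableOn_of_rep r hd hi)) r :=
    newtonLeibnizRel_subset_relations (of_bandRep_sub_of_mem_newtonLeibnizRel ha r hd hi)
  have hE' : Equivalent (bandRep A' B' b hb (integrableOn_of_rep r' hd' hi')) r' :=
    newtonLeibnizRel_subset_relations (of_bandRep_sub_of_mem_newtonLeibnizRel hb r' hd' hi')
  have hvR : (bandRep A B a ha (integrableOn_of_rep r hd hi)).value =
      (bandRep A' B' b hb (integrableOn_of_rep r' hd' hi')).value := by
    rw [Equivalent.value_eq_holds hE, Equivalent.value_eq_holds hE', hv]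
  have hRR' := (KontsevichZagierPeriods_iff.1 h) _ _ (isRational_bandRep A B a ha _)
    (isRational_bandRep A' B' b hb _) hvR
  exact (hE.symm.trans hRR').trans hE'

end Summit.KontsevichZagierPeriods.IsogenyCertificates.RealPeriodSectorCompleteNegative
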